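import Mathlib
import HarnessLib
import Summits.HubbardSuperconductivity.HubbardSuperconductivity.Theorems.KLProgrammeKLRegimeFlowReadScaleZeroChainSplit

/-!
# Route `KLProgramme`, crux K3 — gen-8 ENGINE-FLOW child (stmt-HubbardSuperconductivity-20437 `KLRegimeEngineV17F2`), stub (C) at `n = 0`,
# located item #22a «(C)-SCALE0-PT2», step (π3a): THE DIAGONAL TWO-LEG KERNEL OF THE SCALE-`0` OUTPUT THROUGH SECOND ORDER —
# `kernel₂ W₀ ((p,σ,+),(p,σ,−)) = ½Uε·t₀ + ½(Uε)²·t₀·Σ_q A((p,σ̄)⁺,(q,σ̄)⁻)A((q,σ̄)⁺,(p,σ̄)⁻) + kernel₂ R₃`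

Seat hubbard-kl-k3c5-p1 (g13; owner of #22a).  π1 (p610302 `kernel_two_scaleZero_effAction_offDiag`) computed the kernel at DISTINCT grid points
`p ≠ q` (sunset + Hartree chain + `R₃`).  The MIXED door's ON-SITE row `hBon` (`Σ_{x⃗₁ = x⃗₀}‖kernel₂ W_a‖ ≤ v·|U|·ε`) also reads the COINCIDENT
point `p₁ = p₀`, where the first-order Hartree value `½Uε·t₀` and the second-order RAINBOW `+½(Uε)²t₀·(A²)((p,σ̄),(p,σ̄))` live; a Gram/determinant
bound of that entry (`twoLeg_plain_point_sum_frameZero_le`: `(64/3)e⁹κ₀²·|U|ε ≈ 5·10¹¹|U|ε`) would blow the value row's table `2¹⁰`, so the entry is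
computed EXACTLY here (Wick at coincident legs), for π3b to move it into the momentum-side piece `W_b` as a CONSTANT symbol.
For a charge-conserving, spin-diagonal grid covariance `C` with translation/spin-invariant tadpole `t = A((q,σ)⁺,(q,σ)⁻)`:
* §1 `gridWord_mul_self` (`w_p² = 0`), `iteratedDeriv` at coincident legs: `∂_{ψ⁻_{pσ}}∂_{ψ⁺_{pσ}}(w_p w_q) = ψ⁺_{pσ̄}ψ⁻_{pσ̄}·w_q` (`p ≠ q`);
* §2 Wick: `∫dμ_C ψ⁺_{pσ̄}ψ⁻_{pσ̄} w_q = t·(t² − A((p,σ̄)⁺,(q,σ̄)⁻)A((q,σ̄)⁺,(p,σ̄)⁻))`, and the all-pairs form (`p' = p` or `q' = p`, else `0`);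
* §3 kernels at the diagonal string: `kernel₂ e^{Δ}(V²) = (Uε)²Σ_q t(t² − AA)`, `kernel₂ (e^{Δ}V)² = (Uεt)(Uε·#pts·t²)`, `kernel₂ e^{Δ}V = ½Uεt`;
* §4 **`kernel_two_effAction_hubbardGridInteraction_diag`** (generic `C`) and **`kernel_two_scaleZero_effAction_diag`** (the scale-`0` grid output:
  the `#pts·t³` disconnected pieces CANCEL exactly, BGM's linked-cluster at second order).

Proofs only; no definitions; nothing asserts any stub of 20437, K3 or superconductivity.
References: BGM 2006 §2.1 (2.3)–(2.6), §2.2 (2.14) [cite: BenfattoGiulianiMastropietro2006]; Salmhofer 1999 §4.3 (4.95) [cite: Salmhofer1999].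
-/

noncomputable section

namespace Summit.HubbardSuperconductivity.HubbardSuperconductivity.Theorems.KLRegimeSplit

set_option linter.dupNamespace false -- summit = problem name (single-conjunct summit), D-0017

open Literature.MathematicalPhysics.QuantumLattice Literature.Probability.LatticeModels GrassmannAlgebra Finset Matrix
open Summit.HubbardSuperconductivity.HubbardSuperconductivity.Theorems.EngineV8
open Summit.HubbardSuperconductivity.HubbardSuperconductivity.Theorems.KLRegimeWick (iterDeriv_two)

/-! ## §1 Grid algebra at coincident legs -/

section Grid

variable {L N : ℕ}

/-- **`w_p · w_p = 0`** (the word contains `ψ⁺_{p↑}` twice). -/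
theorem gridWord_mul_self (p : GridPoint L N) : gridWord L N p * gridWord L N p = 0 := by
  simp only [gridWord, mul_assoc]
  rw [gen_mul_gen_mul_swap ℂ (((p, 1), 1) : GridLeg (GridPoint L N)) ((p, 0), 0)]
  simp only [mul_neg]
  rw [gen_mul_gen_mul_swap ℂ (((p, 1), 0) : GridLeg (GridPoint L N)) ((p, 0), 0)]
  simp only [mul_neg, neg_neg]
  rw [gen_mul_gen_mul_swap ℂ (((p, 0), 1) : GridLeg (GridPoint L N)) ((p, 0), 0)]
  simp only [mul_neg]
  rw [← mul_assoc (gen ℂ (((p, 0), 0) : GridLeg (GridPoint L N))), GrassmannAlgebra.gen_mul_self, zero_mul, neg_zero]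

/-- **Two external derivatives at COINCIDENT legs, spin `↑`**: for `p ≠ q`, `∂_{ψ⁻_{p↑}}∂_{ψ⁺_{p↑}}(w_p w_q) = ψ⁺_{p↓}ψ⁻_{p↓}·w_q` (a paired monomial). -/
theorem iterDeriv_two_gridWord_self_mul_gridWord_up (p q : GridPoint L N) (hpq : p ≠ q) :
    iterDeriv ℂ ![(((p, 0), 0) : GridLeg (GridPoint L N)), ((p, 0), 1)] (gridWord L N p * gridWord L N q) =
      genPairProd ℂ ![(((p, 1), 0) : GridLeg (GridPoint L N)), ((q, 0), 0), ((q, 1), 0)]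
        ![(((p, 1), 1) : GridLeg (GridPoint L N)), ((q, 0), 1), ((q, 1), 1)] := by
  rw [iterDeriv_two]
  simp only [gridWord, mul_assoc]
  simp only [grassmannDeriv_gen_mul, grassmannDeriv_gen, Prod.mk.injEq, hpq, and_true, and_false,
    if_true, if_false, and_self, one_ne_zero, zero_ne_one, mul_zero, sub_zero, sub_self]
  simp only [genPairProd, List.ofFn_succ, List.ofFn_zero, Matrix.cons_val_zero, Matrix.cons_val_succ, List.prod_cons, List.prod_nil,
    mul_one, mul_assoc]

/-- **The same, spin `↓`**: for `p ≠ q`, `∂_{ψ⁻_{p↓}}∂_{ψ⁺_{p↓}}(w_p w_q) = ψ⁺_{p↑}ψ⁻_{p↑}·w_q`. -/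
theorem iterDeriv_two_gridWord_self_mul_gridWord_down (p q : GridPoint L N) (hpq : p ≠ q) :
    iterDeriv ℂ ![(((p, 1), 0) : GridLeg (GridPoint L N)), ((p, 1), 1)] (gridWord L N p * gridWord L N q) =
      genPairProd ℂ ![(((p, 0), 0) : GridLeg (GridPoint L N)), ((q, 0), 0), ((q, 1), 0)]
        ![(((p, 0), 1) : GridLeg (GridPoint L N)), ((q, 0), 1), ((q, 1), 1)] := by
  rw [iterDeriv_two]
  simp only [gridWord, mul_assoc]
  simp only [grassmannDeriv_gen_mul, grassmannDeriv_gen, Prod.mk.injEq, hpq, and_true, and_false,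
    if_true, if_false, and_self, one_ne_zero, zero_ne_one, mul_zero, sub_zero, zero_sub, mul_neg, neg_neg, sub_self]
  simp only [genPairProd, List.ofFn_succ, List.ofFn_zero, Matrix.cons_val_zero, Matrix.cons_val_succ, List.prod_cons, List.prod_nil,
    mul_one, mul_assoc]

end Grid

/-! ## §2 Wick at coincident legs -/

section Wick

variable {L N : ℕ} [NeZero L] (C : Matrix (GridLeg (GridPoint L N)) (GridLeg (GridPoint L N)) ℂ)
  (hcharge : ∀ X Y : GridLeg (GridPoint L N), X.2 = Y.2 → contr ℂ C X Y = 0)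
  (hspin : ∀ X Y : GridLeg (GridPoint L N), X.1.2 ≠ Y.1.2 → contr ℂ C X Y = 0)
  {t : ℂ} (ht : ∀ (q : GridPoint L N) (σ : Fin 2), contr ℂ C (((q, σ), 0) : GridLeg (GridPoint L N)) ((q, σ), 1) = t)
include hcharge hspin ht

/-- **Wick at coincident legs, spin `↑`**: `∫dμ_C ∂_{ψ⁻_{p↑}}∂_{ψ⁺_{p↑}}(w_p w_q) = t·(t² − A(p↓⁺,q↓⁻)A(q↓⁺,p↓⁻))` (`p ≠ q`): TADPOLE·(BUBBLE) — the rainbow. -/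
theorem gaussExpect_iterDeriv_two_self_up (p q : GridPoint L N) (hpq : p ≠ q) :
    gaussExpect ℂ C (iterDeriv ℂ ![(((p, 0), 0) : GridLeg (GridPoint L N)), ((p, 0), 1)] (gridWord L N p * gridWord L N q)) =
      t * (t ^ 2 - contr ℂ C (((p, 1), 0) : GridLeg (GridPoint L N)) ((q, 1), 1) * contr ℂ C (((q, 1), 0) : GridLeg (GridPoint L N)) ((p, 1), 1)) := by
  rw [iterDeriv_two_gridWord_self_mul_gridWord_up p q hpq, gaussExpect_genPairProd ℂ C _ _ (fun i j => hcharge _ _ (by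
    fin_cases i <;> fin_cases j <;> rfl)), Matrix.det_fin_three]
  have z01 : contr ℂ C (((p, 1), 0) : GridLeg (GridPoint L N)) ((q, 0), 1) = 0 := hspin _ _ (by simp)
  have z10 : contr ℂ C (((q, 0), 0) : GridLeg (GridPoint L N)) ((p, 1), 1) = 0 := hspin _ _ (by simp)
  have z12 : contr ℂ C (((q, 0), 0) : GridLeg (GridPoint L N)) ((q, 1), 1) = 0 := hspin _ _ (by simp)
  have z21 : contr ℂ C (((q, 1), 0) : GridLeg (GridPoint L N)) ((q, 0), 1) = 0 := hspin _ _ (by simp)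
  simp only [Matrix.of_apply, Matrix.cons_val_zero, Matrix.cons_val_one, Matrix.cons_val_two, Matrix.head_cons, Matrix.tail_cons,
    z01, z10, z12, z21, ht]
  ring

/-- **The same, spin `↓`**: `∫dμ_C ∂_{ψ⁻_{p↓}}∂_{ψ⁺_{p↓}}(w_p w_q) = t·(t² − A(p↑⁺,q↑⁻)A(q↑⁺,p↑⁻))`. -/
theorem gaussExpect_iterDeriv_two_self_down (p q : GridPoint L N) (hpq : p ≠ q) :
    gaussExpect ℂ C (iterDeriv ℂ ![(((p, 1), 0) : GridLeg (GridPoint L N)), ((p, 1), 1)] (gridWord L N p * gridWord L N q)) =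
      t * (t ^ 2 - contr ℂ C (((p, 0), 0) : GridLeg (GridPoint L N)) ((q, 0), 1) * contr ℂ C (((q, 0), 0) : GridLeg (GridPoint L N)) ((p, 0), 1)) := by
  rw [iterDeriv_two_gridWord_self_mul_gridWord_down p q hpq, gaussExpect_genPairProd ℂ C _ _ (fun i j => hcharge _ _ (by
    fin_cases i <;> fin_cases j <;> rfl)), Matrix.det_fin_three]
  have z02 : contr ℂ C (((p, 0), 0) : GridLeg (GridPoint L N)) ((q, 1), 1) = 0 := hspin _ _ (by simp)
  have z20 : contr ℂ C (((q, 1), 0) : GridLeg (GridPoint L N)) ((p, 0), 1) = 0 := hspin _ _ (by simp)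
  have z12 : contr ℂ C (((q, 0), 0) : GridLeg (GridPoint L N)) ((q, 1), 1) = 0 := hspin _ _ (by simp)
  have z21 : contr ℂ C (((q, 1), 0) : GridLeg (GridPoint L N)) ((q, 0), 1) = 0 := hspin _ _ (by simp)
  simp only [Matrix.of_apply, Matrix.cons_val_zero, Matrix.cons_val_one, Matrix.cons_val_two, Matrix.head_cons, Matrix.tail_cons,
    z02, z20, z12, z21, ht]
  ring

/-- **Both spins**: `∫dμ_C ∂_{ψ⁻_{pσ}}∂_{ψ⁺_{pσ}}(w_p w_q) = t·(t² − A((p,σ̄)⁺,(q,σ̄)⁻)·A((q,σ̄)⁺,(p,σ̄)⁻))`, `p ≠ q`. -/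
theorem gaussExpect_iterDeriv_two_self (p q : GridPoint L N) (hpq : p ≠ q) (σ : Fin 2) :
    gaussExpect ℂ C (iterDeriv ℂ ![(((p, σ), 0) : GridLeg (GridPoint L N)), ((p, σ), 1)] (gridWord L N p * gridWord L N q)) =
      t * (t ^ 2 - contr ℂ C (((p, σ.rev), 0) : GridLeg (GridPoint L N)) ((q, σ.rev), 1) *
        contr ℂ C (((q, σ.rev), 0) : GridLeg (GridPoint L N)) ((p, σ.rev), 1)) := by
  fin_cases σ
  · exact gaussExpect_iterDeriv_two_self_up C hcharge hspin ht p q hpq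
  · exact gaussExpect_iterDeriv_two_self_down C hcharge hspin ht p q hpq

/-- **All word pairs at once**: `∫dμ_C ∂_{ψ⁻_{pσ}}∂_{ψ⁺_{pσ}}(w_{p'} w_{q'}) = [p' = p]·E(q') + [q' = p]·E(p')`, `E(q) = t(t² − A((p,σ̄)⁺,(q,σ̄)⁻)A((q,σ̄)⁺,(p,σ̄)⁻))`
(`E(p) = 0` by `ht`, consistent with `w_p² = 0`). -/
theorem gaussExpect_iterDeriv_two_self_eq_ite (p : GridPoint L N) (σ : Fin 2) (p' q' : GridPoint L N) :
    gaussExpect ℂ C (iterDeriv ℂ ![(((p, σ), 0) : GridLeg (GridPoint L N)), ((p, σ), 1)] (gridWord L N p' * gridWord L N q')) =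
      (if p' = p then t * (t ^ 2 - contr ℂ C (((p, σ.rev), 0) : GridLeg (GridPoint L N)) ((q', σ.rev), 1) *
          contr ℂ C (((q', σ.rev), 0) : GridLeg (GridPoint L N)) ((p, σ.rev), 1)) else 0) +
      (if q' = p then t * (t ^ 2 - contr ℂ C (((p, σ.rev), 0) : GridLeg (GridPoint L N)) ((p', σ.rev), 1) *
          contr ℂ C (((p', σ.rev), 0) : GridLeg (GridPoint L N)) ((p, σ.rev), 1)) else 0) := by
  by_cases h1 : p' = p
  · subst h1
    rw [if_pos rfl]
    by_cases h2 : q' = p'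
    · subst h2
      rw [if_pos rfl, gridWord_mul_self, map_zero, map_zero, ht]
      ring
    · rw [if_neg h2, add_zero, gaussExpect_iterDeriv_two_self C hcharge hspin ht p' q' (fun h => h2 h.symm) σ]
  · rw [if_neg h1, zero_add]
    by_cases h3 : q' = p
    · subst h3
      rw [if_pos rfl, gridWord_mul_comm, gaussExpect_iterDeriv_two_self C hcharge hspin ht q' p' (fun h => h1 h.symm) σ]
    · rw [if_neg h3, iterDeriv_two_gridWord_mul_gridWord_eq_zero_left p' q' p p (fun h => h1 h.symm) (fun h => h3 h.symm) σ, map_zero]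

end Wick

/-! ## §3 Kernels at the diagonal string `((p,σ),+),((p,σ),−)` -/

section SecondCumulantDiag

variable {L N : ℕ} [NeZero L] (C : Matrix (GridLeg (GridPoint L N)) (GridLeg (GridPoint L N)) ℂ)

/-- **`kernel₂ (Σ_{q,σ'} ψ⁺_{qσ'}ψ⁻_{qσ'}) ((p,σ,+),(p,σ,−)) = ½`** (the antisymmetrised kernel of the one matching monomial). -/
theorem kernel_two_onSiteDensity_self (p : GridPoint L N) (σ : Fin 2) :
    kernel ℂ (∑ q : GridPoint L N, ∑ σ' : Fin 2,
        gen ℂ (((q, σ'), 0) : GridLeg (GridPoint L N)) * gen ℂ (((q, σ'), 1) : GridLeg (GridPoint L N))) 2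
      (fun i => ((![p, p] i, σ), i)) = (2 : ℂ)⁻¹ := by
  rw [twoLegString_eq]
  simp only [kernel_sum, kernel_two_gen_mul_gen, Matrix.cons_val_zero, Matrix.cons_val_one, Prod.mk.injEq, and_true,
    zero_ne_one, and_false, if_false, one_ne_zero, mul_zero, sub_zero]
  rw [Finset.sum_eq_single_of_mem p (Finset.mem_univ _) (fun q _ hq => by
        have h : ¬p = q := fun h => hq h.symm
        simp only [h, false_and, if_false, mul_zero, Finset.sum_const_zero]),
    Finset.sum_eq_single_of_mem σ (Finset.mem_univ _) (fun σ' _ hσ' => by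
        have h : ¬σ = σ' := fun h => hσ' h.symm
        simp only [h, and_false, if_false, mul_zero])]
  simp only [and_self, if_true, mul_one]

/-- `(Σψ⁺ψ⁻)·(Σψ⁺ψ⁻)` has no two-leg kernel at ANY string (each term is a monomial of degree `4`). -/
theorem kernel_two_onSiteDensity_mul_self_any (Y : Fin 2 → GridLeg (GridPoint L N)) :
    kernel ℂ ((∑ q : GridPoint L N, ∑ σ : Fin 2,
        gen ℂ (((q, σ), 0) : GridLeg (GridPoint L N)) * gen ℂ (((q, σ), 1) : GridLeg (GridPoint L N))) *
      (∑ q : GridPoint L N, ∑ σ : Fin 2,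
        gen ℂ (((q, σ), 0) : GridLeg (GridPoint L N)) * gen ℂ (((q, σ), 1) : GridLeg (GridPoint L N)))) 2 Y = 0 := by
  rw [Finset.sum_mul_sum, kernel_sum]
  refine Finset.sum_eq_zero fun q _ => ?_
  rw [kernel_sum]
  refine Finset.sum_eq_zero fun q' _ => ?_
  rw [Finset.sum_mul_sum, kernel_sum]
  refine Finset.sum_eq_zero fun σ _ => ?_
  rw [kernel_sum]
  refine Finset.sum_eq_zero fun σ' _ => ?_
  rw [gen_mul_gen_eq_genProd_two, gen_mul_gen_eq_genProd_two, ← genProd_append]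
  exact kernel_genProd_of_ne ℂ Y _ (by omega)

/-- `(Σψ⁺ψ⁻)·V_N` and `V_N·(Σψ⁺ψ⁻)` have no two-leg kernel at ANY string (degree `6`). -/
theorem kernel_two_onSiteDensity_mul_hubbardGridInteraction_any (β U : ℝ) (Y : Fin 2 → GridLeg (GridPoint L N)) :
    kernel ℂ ((∑ q : GridPoint L N, ∑ σ : Fin 2,
        gen ℂ (((q, σ), 0) : GridLeg (GridPoint L N)) * gen ℂ (((q, σ), 1) : GridLeg (GridPoint L N))) *
      hubbardGridInteraction L N β U) 2 Y = 0 ∧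
    kernel ℂ (hubbardGridInteraction L N β U * (∑ q : GridPoint L N, ∑ σ : Fin 2,
        gen ℂ (((q, σ), 0) : GridLeg (GridPoint L N)) * gen ℂ (((q, σ), 1) : GridLeg (GridPoint L N)))) 2 Y = 0 := by
  constructor
  · rw [Finset.sum_mul, kernel_sum]
    refine Finset.sum_eq_zero fun q _ => ?_
    rw [Finset.sum_mul, kernel_sum]
    refine Finset.sum_eq_zero fun σ _ => ?_
    rw [gen_mul_gen_eq_genProd_two]
    exact (kernel_two_hubbardGridInteraction_mul_genProd β U _ Y).2
  · rw [Finset.mul_sum, kernel_sum]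
    refine Finset.sum_eq_zero fun q _ => ?_
    rw [Finset.mul_sum, kernel_sum]
    refine Finset.sum_eq_zero fun σ _ => ?_
    rw [gen_mul_gen_eq_genProd_two]
    exact (kernel_two_hubbardGridInteraction_mul_genProd β U _ Y).1

variable (hcharge : ∀ X Y : GridLeg (GridPoint L N), X.2 = Y.2 → contr ℂ C X Y = 0)
  (hspin : ∀ X Y : GridLeg (GridPoint L N), X.1.2 ≠ Y.1.2 → contr ℂ C X Y = 0)
  {t : ℂ} (ht : ∀ (q : GridPoint L N) (σ : Fin 2), contr ℂ C (((q, σ), 0) : GridLeg (GridPoint L N)) ((q, σ), 1) = t)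
include hcharge hspin ht

/-- **THE TWO-LEG KERNEL OF `e^{Δ_C}(V_N²)` AT THE DIAGONAL STRING**: `kernel₂ (e^{Δ_C}(V_N·V_N)) ((p,σ,+),(p,σ,−)) =
(Uε_N)²·Σ_q t·(t² − A((p,σ̄)⁺,(q,σ̄)⁻)A((q,σ̄)⁺,(p,σ̄)⁻))` (the words `w_p w_q` and `w_q w_p` each give `½E(q)`; `q = p` contributes `E(p) = 0`). -/
theorem kernel_two_gaussConv_hubbardGridInteraction_mul_self_diag (β U : ℝ) (p : GridPoint L N) (σ : Fin 2) :
    kernel ℂ (gaussConv ℂ C (hubbardGridInteraction L N β U * hubbardGridInteraction L N β U)) 2 (fun i => ((![p, p] i, σ), i)) =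
      ((U * (β / N) : ℝ) : ℂ) ^ 2 * ∑ q : GridPoint L N, t * (t ^ 2 -
        contr ℂ C (((p, σ.rev), 0) : GridLeg (GridPoint L N)) ((q, σ.rev), 1) *
          contr ℂ C (((q, σ.rev), 0) : GridLeg (GridPoint L N)) ((p, σ.rev), 1)) := by
  classical
  rw [twoLegString_eq]
  have hVV : hubbardGridInteraction L N β U * hubbardGridInteraction L N β U =
      (((U * (β / N) : ℝ) : ℂ) * ((U * (β / N) : ℝ) : ℂ)) •
        ∑ p' : GridPoint L N, ∑ q' : GridPoint L N, gridWord L N p' * gridWord L N q' := by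
    rw [hubbardGridInteraction, Algebra.smul_mul_assoc, Algebra.mul_smul_comm, smul_smul, Finset.sum_mul_sum]
  rw [hVV, map_smul, kernel_smul, map_sum, kernel_sum]
  have hsum : ∑ p' : GridPoint L N, kernel ℂ (gaussConv ℂ C (∑ q' : GridPoint L N, gridWord L N p' * gridWord L N q')) 2
        ![(((p, σ), 0) : GridLeg (GridPoint L N)), ((p, σ), 1)] =
      ∑ p' : GridPoint L N, ∑ q' : GridPoint L N, ((Nat.factorial 2 : ℚ)⁻¹ • (1 : ℂ)) *
        ((if p' = p then t * (t ^ 2 - contr ℂ C (((p, σ.rev), 0) : GridLeg (GridPoint L N)) ((q', σ.rev), 1) *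
            contr ℂ C (((q', σ.rev), 0) : GridLeg (GridPoint L N)) ((p, σ.rev), 1)) else 0) +
         (if q' = p then t * (t ^ 2 - contr ℂ C (((p, σ.rev), 0) : GridLeg (GridPoint L N)) ((p', σ.rev), 1) *
            contr ℂ C (((p', σ.rev), 0) : GridLeg (GridPoint L N)) ((p, σ.rev), 1)) else 0)) := by
    refine Finset.sum_congr rfl fun p' _ => ?_
    rw [map_sum, kernel_sum]
    refine Finset.sum_congr rfl fun q' _ => ?_
    rw [kernel_gaussConv_eq_gaussExpect_iterDeriv, gaussExpect_iterDeriv_two_self_eq_ite C hcharge hspin ht p σ p' q']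
  have h2 : ((Nat.factorial 2 : ℚ)⁻¹ • (1 : ℂ)) = (2 : ℂ)⁻¹ := by
    rw [Rat.smul_one_eq_cast]; push_cast [Nat.factorial]; norm_num
  have hA : ∑ p' : GridPoint L N, ∑ q' : GridPoint L N,
      (if p' = p then t * (t ^ 2 - contr ℂ C (((p, σ.rev), 0) : GridLeg (GridPoint L N)) ((q', σ.rev), 1) *
        contr ℂ C (((q', σ.rev), 0) : GridLeg (GridPoint L N)) ((p, σ.rev), 1)) else 0) =
      ∑ q' : GridPoint L N, t * (t ^ 2 - contr ℂ C (((p, σ.rev), 0) : GridLeg (GridPoint L N)) ((q', σ.rev), 1) *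
        contr ℂ C (((q', σ.rev), 0) : GridLeg (GridPoint L N)) ((p, σ.rev), 1)) := by
    rw [Finset.sum_comm]
    refine Finset.sum_congr rfl fun q' _ => ?_
    simp only [Finset.sum_ite_eq', Finset.mem_univ, if_true]
  have hB : ∑ p' : GridPoint L N, ∑ q' : GridPoint L N,
      (if q' = p then t * (t ^ 2 - contr ℂ C (((p, σ.rev), 0) : GridLeg (GridPoint L N)) ((p', σ.rev), 1) *
        contr ℂ C (((p', σ.rev), 0) : GridLeg (GridPoint L N)) ((p, σ.rev), 1)) else 0) =
      ∑ p' : GridPoint L N, t * (t ^ 2 - contr ℂ C (((p, σ.rev), 0) : GridLeg (GridPoint L N)) ((p', σ.rev), 1) *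
        contr ℂ C (((p', σ.rev), 0) : GridLeg (GridPoint L N)) ((p, σ.rev), 1)) := by
    refine Finset.sum_congr rfl fun p' _ => ?_
    simp only [Finset.sum_ite_eq', Finset.mem_univ, if_true]
  rw [hsum, h2]
  simp only [mul_add, Finset.sum_add_distrib, ← Finset.mul_sum, hA, hB]
  ring

/-- **`kernel₂ (e^{Δ_C}V_N) ((p,σ,+),(p,σ,−)) = ½·Uε_N·t`** — the first-order (Hartree) diagonal entry. -/
theorem kernel_two_gaussConv_hubbardGridInteraction_diag [NeZero N] (β U : ℝ) (p : GridPoint L N) (σ : Fin 2) :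
    kernel ℂ (gaussConv ℂ C (hubbardGridInteraction L N β U)) 2 (fun i => ((![p, p] i, σ), i)) =
      (2 : ℂ)⁻¹ * (((U * (β / N) : ℝ) : ℂ) * t) := by
  obtain ⟨hV, -, h1⟩ := kernel_two_hubbardGridInteraction_facts (L := L) (N := N) β U (fun i => (((![p, p] i, σ), i) : GridLeg (GridPoint L N)))
  have hS := kernel_two_onSiteDensity_self (L := L) (N := N) p σ
  rw [gaussConv_hubbardGridInteraction_eq C hcharge hspin ht β U, kernel_add, kernel_add, kernel_smul, kernel_smul, hV, hS, h1]
  ring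

/-- **`kernel₂ ((e^{Δ_C}V_N)²) ((p,σ,+),(p,σ,−)) = (Uε_N t)·(Uε_N·#pts·t²)`** — the only quadratic monomials of the square are the cross terms
`2·(Uε t·Σψ⁺ψ⁻)·(Uε·#pts·t²·1)` (disconnected: `#pts` = number of grid points). -/
theorem kernel_two_gaussConv_hubbardGridInteraction_sq_diag [NeZero N] (β U : ℝ) (p : GridPoint L N) (σ : Fin 2) :
    kernel ℂ (gaussConv ℂ C (hubbardGridInteraction L N β U) * gaussConv ℂ C (hubbardGridInteraction L N β U)) 2
        (fun i => ((![p, p] i, σ), i)) =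
      (((U * (β / N) : ℝ) : ℂ) * t) * (((U * (β / N) : ℝ) : ℂ) * (Fintype.card (GridPoint L N) : ℂ) * (t * t)) := by
  obtain ⟨hV, hVV, h1⟩ := kernel_two_hubbardGridInteraction_facts (L := L) (N := N) β U (fun i => (((![p, p] i, σ), i) : GridLeg (GridPoint L N)))
  have hS := kernel_two_onSiteDensity_self (L := L) (N := N) p σ
  have hSS := kernel_two_onSiteDensity_mul_self_any (L := L) (N := N) (fun i => (((![p, p] i, σ), i) : GridLeg (GridPoint L N)))
  obtain ⟨hSV, hVS⟩ := kernel_two_onSiteDensity_mul_hubbardGridInteraction_any (L := L) (N := N) β U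
    (fun i => (((![p, p] i, σ), i) : GridLeg (GridPoint L N)))
  rw [gaussConv_hubbardGridInteraction_eq C hcharge hspin ht β U]
  simp only [add_mul, mul_add, smul_mul_assoc, mul_smul_comm, one_mul, mul_one, kernel_add, kernel_smul,
    hS, hSS, hSV, hVS, hV, hVV, h1, mul_zero, add_zero, zero_add]
  ring

/-- **THE TWO-LEG KERNEL OF `W = effAction C V_N` AT THE DIAGONAL = FIRST + SECOND ORDER EXPLICIT + ORDER-≥3 REMAINDER**:
`kernel₂ W ((p,σ,+),(p,σ,−)) = ½Uε·t + ½(Uε)²·t·Σ_q A((p,σ̄)⁺,(q,σ̄)⁻)A((q,σ̄)⁺,(p,σ̄)⁻) + kernel₂ R₃ (…)`,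
`R₃ = W − e^{Δ}V + ½(e^{Δ}(V²) − (e^{Δ}V)²)`: the disconnected `#pts·t³` pieces of `e^{Δ}(V²)` and `(e^{Δ}V)²` cancel exactly (linked cluster). -/
theorem kernel_two_effAction_hubbardGridInteraction_diag [NeZero N] (β U : ℝ) (p : GridPoint L N) (σ : Fin 2) :
    kernel ℂ (effAction ℂ C (hubbardGridInteraction L N β U)) 2 (fun i => ((![p, p] i, σ), i)) =
      (2 : ℂ)⁻¹ * (((U * (β / N) : ℝ) : ℂ) * t) +
      (2 : ℂ)⁻¹ * (((U * (β / N) : ℝ) : ℂ) ^ 2 * (t * ∑ q : GridPoint L N,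
        contr ℂ C (((p, σ.rev), 0) : GridLeg (GridPoint L N)) ((q, σ.rev), 1) *
          contr ℂ C (((q, σ.rev), 0) : GridLeg (GridPoint L N)) ((p, σ.rev), 1))) +
      kernel ℂ (effAction ℂ C (hubbardGridInteraction L N β U) - gaussConv ℂ C (hubbardGridInteraction L N β U) +
        (2 : ℂ)⁻¹ • (gaussConv ℂ C (hubbardGridInteraction L N β U * hubbardGridInteraction L N β U) -
          gaussConv ℂ C (hubbardGridInteraction L N β U) * gaussConv ℂ C (hubbardGridInteraction L N β U))) 2
        (fun i => ((![p, p] i, σ), i)) := by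
  have h1 := kernel_two_gaussConv_hubbardGridInteraction_diag C hcharge hspin ht β U p σ
  have h2 := kernel_two_gaussConv_hubbardGridInteraction_mul_self_diag C hcharge hspin ht β U p σ
  have h3 := kernel_two_gaussConv_hubbardGridInteraction_sq_diag C hcharge hspin ht β U p σ
  have hsplit : ∑ q : GridPoint L N, t * (t ^ 2 -
        contr ℂ C (((p, σ.rev), 0) : GridLeg (GridPoint L N)) ((q, σ.rev), 1) *
          contr ℂ C (((q, σ.rev), 0) : GridLeg (GridPoint L N)) ((p, σ.rev), 1)) =
      (Fintype.card (GridPoint L N) : ℂ) * t ^ 3 - t * ∑ q : GridPoint L N,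
        contr ℂ C (((p, σ.rev), 0) : GridLeg (GridPoint L N)) ((q, σ.rev), 1) *
          contr ℂ C (((q, σ.rev), 0) : GridLeg (GridPoint L N)) ((p, σ.rev), 1) := by
    simp only [mul_sub, Finset.sum_sub_distrib, Finset.sum_const, Finset.card_univ, nsmul_eq_mul, ← Finset.mul_sum]
    ring
  rw [hsplit] at h2
  rw [kernel_add, kernel_sub_apply, kernel_smul, kernel_sub_apply, h1, h2, h3]
  ring

end SecondCumulantDiag

/-! ## §4 The scale-`0` instance at the diagonal -/

section Model

variable {L M : ℕ} [NeZero L] [NeZero M]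

/-- **THE DIAGONAL TWO-LEG KERNEL OF THE SCALE-`0` GRID OUTPUT `W₀` THROUGH SECOND ORDER** (located item #22a, step (π3a)): for every grid point `p` of the
`4M`-grid and every spin `σ`, with `A = contr (S_{4M}ᵀC⁰_{>e₀}S_{4M})` and the scale-`0` tadpole `t₀ = −Σ_k (βL²)^{−2}Ψ⁰(k,0)`,
`kernel₂ W₀ ((p,σ,+),(p,σ,−)) = ½(Uβ/4M)·t₀ + ½(Uβ/4M)²·t₀·Σ_q A((p,σ̄)⁺,(q,σ̄)⁻)A((q,σ̄)⁺,(p,σ̄)⁻) + kernel₂ R₃ ((p,σ,+),(p,σ,−))`. -/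
theorem kernel_two_scaleZero_effAction_diag (β U μ : ℝ) (p : GridPoint L (2 * (2 * M))) (σ : Fin 2) :
    kernel ℂ (effAction ℂ ((hubbardGridSub L M β (2 * (2 * M))).transpose * hubbardCovAboveCT L M β μ 0 0 klE0 *
        hubbardGridSub L M β (2 * (2 * M))) (hubbardGridInteraction L (2 * (2 * M)) β U)) 2 (fun i => ((![p, p] i, σ), i)) =
      (2 : ℂ)⁻¹ * (((U * (β / (2 * (2 * M) : ℕ)) : ℝ) : ℂ) *
        (-∑ k : FreqMomentum L M, ((1 / (β * (L : ℝ) ^ 2) : ℝ) : ℂ) ^ 2 * uvSymbolCT L M β μ 0 klE0 (k, 0))) +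
      (2 : ℂ)⁻¹ * (((U * (β / (2 * (2 * M) : ℕ)) : ℝ) : ℂ) ^ 2 *
        ((-∑ k : FreqMomentum L M, ((1 / (β * (L : ℝ) ^ 2) : ℝ) : ℂ) ^ 2 * uvSymbolCT L M β μ 0 klE0 (k, 0)) *
          ∑ q : GridPoint L (2 * (2 * M)),
            contr ℂ ((hubbardGridSub L M β (2 * (2 * M))).transpose * hubbardCovAboveCT L M β μ 0 0 klE0 *
                hubbardGridSub L M β (2 * (2 * M))) (((p, σ.rev), 0) : GridLeg (GridPoint L (2 * (2 * M)))) ((q, σ.rev), 1) *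
              contr ℂ ((hubbardGridSub L M β (2 * (2 * M))).transpose * hubbardCovAboveCT L M β μ 0 0 klE0 *
                hubbardGridSub L M β (2 * (2 * M))) (((q, σ.rev), 0) : GridLeg (GridPoint L (2 * (2 * M)))) ((p, σ.rev), 1))) +
      kernel ℂ (effAction ℂ ((hubbardGridSub L M β (2 * (2 * M))).transpose * hubbardCovAboveCT L M β μ 0 0 klE0 *
            hubbardGridSub L M β (2 * (2 * M))) (hubbardGridInteraction L (2 * (2 * M)) β U) -
          gaussConv ℂ ((hubbardGridSub L M β (2 * (2 * M))).transpose * hubbardCovAboveCT L M β μ 0 0 klE0 *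
            hubbardGridSub L M β (2 * (2 * M))) (hubbardGridInteraction L (2 * (2 * M)) β U) +
        (2 : ℂ)⁻¹ • (gaussConv ℂ ((hubbardGridSub L M β (2 * (2 * M))).transpose * hubbardCovAboveCT L M β μ 0 0 klE0 *
              hubbardGridSub L M β (2 * (2 * M))) (hubbardGridInteraction L (2 * (2 * M)) β U * hubbardGridInteraction L (2 * (2 * M)) β U) -
          gaussConv ℂ ((hubbardGridSub L M β (2 * (2 * M))).transpose * hubbardCovAboveCT L M β μ 0 0 klE0 *
              hubbardGridSub L M β (2 * (2 * M))) (hubbardGridInteraction L (2 * (2 * M)) β U) *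
            gaussConv ℂ ((hubbardGridSub L M β (2 * (2 * M))).transpose * hubbardCovAboveCT L M β μ 0 0 klE0 *
              hubbardGridSub L M β (2 * (2 * M))) (hubbardGridInteraction L (2 * (2 * M)) β U))) 2
        (fun i => ((![p, p] i, σ), i)) := by
  haveI : NeZero (2 * (2 * M)) := ⟨by have := NeZero.ne M; omega⟩
  exact kernel_two_effAction_hubbardGridInteraction_diag _ (contr_scaleZeroGridCov_of_charge_eq β μ) (contr_scaleZeroGridCov_of_spin_ne β μ)
    (fun q' σ' => contr_scaleZeroGridCov_samePoint β μ q' σ') β U p σ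

end Model

end Summit.HubbardSuperconductivity.HubbardSuperconductivity.Theorems.KLRegimeSplit

end
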